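import Mathlib
import HarnessLib
import Summits.NavierStokesRegularity.NavierStokesRegularity.Theorems.TaylorModelRungThreeVRadiiStep
import Summits.NavierStokesRegularity.NavierStokesRegularity.Theorems.TaylorModelRungThreeReadoutVTube

/-!
# Line `taylor-model` on crux K1b-DR (stmt-NavierStokesRegularity-23954) — G1-v (node part): the NODE INVARIANT of
# every polytope trajectory under the v3 certificate

From `ChainVCore` (tm-g4), `ChainVRadii` (engine-1 g67: ENTRY, hinge, and the node step `nodePair_step`) and the
flow package `IsFlowPackageV`: for every polytope point `q` of stage `j` (parameter `ζ` from ENTRY,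
`q = x j 0 + Dsc ζ` on the window), the selector trajectories of `q` and of the base point `x j 0` solve K1b-DR's ODE
clause on `[0, Tn s]` for every node `s ≤ S`, and their node states form a level-1 NODE PAIR
`NodePair j s ζ (φ(x j 0)(Tn s)) (φ(q)(Tn s))` — hence (hinge) `φ(q)(Tn s) ∈ H¹_s` and `φ(x j 0)(Tn s) ∈ X⁰_s ⊆ H⁰_s`.
This is the hypothesis `hPN` of G2-v (`…ReadoutVCrossing`) and G3-v (`…ReadoutVTube/…Deriv`).

* `eq_of_wsupp_of_window` — window-supported states agreeing on the window are equal;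
* `polyNodesV` — the induction; `polyInvariantV` — the packaged node invariant (levels 1 and 0) for all stages.

MODEL-lattice rung TL-M3 only; nothing here is a statement about the Navier–Stokes equations.
-/

noncomputable section

-- the sub-problem namespace repeats the summit name by design (D-0017)
set_option linter.dupNamespace false

namespace Summit.NavierStokesRegularity.NavierStokesRegularity.Theorems.TaylorModelV

open Set Finset
open Literature.Analysis.FluidPDE.TaoCascade Literature.Analysis.FluidPDE.TaoCascade.TaylorChain
open Summit.NavierStokesRegularity.NavierStokesRegularity.Theorems.TaylorModelReadout

variable {cd : CertData} {bx : StepBoxes} {rd : RadiiData} {φ : Flow}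

/-- Window-supported states that agree on the window are equal. [folklore] -/
theorem eq_of_wsupp_of_window {y y' : Fin 4 → ℤ → ℝ} (hy : cd.Wsupp y) (hy' : cd.Wsupp y')
    (h : ∀ i k, -cd.Kb ≤ k → k ≤ cd.Ka → y i k = y' i k) : y = y' := by
  funext i k
  by_cases hk : -cd.Kb ≤ k ∧ k ≤ cd.Ka
  · exact h i k hk.1 hk.2
  · rw [hy i k hk, hy' i k hk]

/-- **G1-v, node part: the node invariant of a polytope trajectory.** [folklore] -/
theorem polyNodesV (hC : ChainVCore cd bx) (hR : ChainVRadii cd bx rd) (hF : IsFlowPackageV cd bx φ) {j : ℕ}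
    (hj : j ≤ cd.N₀) {q : Fin 4 → ℤ → ℝ} (hq : InPoly cd j q) :
    ∃ ζ : Fin 4 → ℤ → ℝ, AbsLeW cd ζ (rd.rB j) ∧
      (∀ i k, -cd.Kb ≤ k → k ≤ cd.Ka → q i k = (cd.x j 0 + rd.Dsc j ζ) i k) ∧
      ∀ s, s ≤ cd.S j →
        SolvesOn cd φ j q (cd.Tn j s) ∧ SolvesOn cd φ j (cd.x j 0) (cd.Tn j s) ∧
          NodePair cd bx rd j s ζ (stAt φ j (cd.x j 0) (cd.Tn j s)) (stAt φ j q (cd.Tn j s)) := by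
  have hU := isUniqueFlow_of_packageV hF
  obtain ⟨-, -, -, hENTRY, hVc0, -, hRn, -⟩ := hR j hj
  obtain ⟨ζ, hζ, hqζ⟩ := hENTRY q hq
  refine ⟨ζ, hζ, hqζ, ?_⟩
  -- node clauses of `ChainVCore` / `ChainVRadii`
  have hA := (hC j hj).2.2.1
  have hT0 : cd.Tn j 0 = 0 := (gridV hC hj).1
  -- hull memberships from a node pair
  have hH2y : ∀ s, s ≤ cd.S j → ∀ {ζ' y₀ y}, NodePair cd bx rd j s ζ' y₀ y →
      InBox cd (bx.hlo 2 j s) (bx.hhi 2 j s) y ∧ InBox cd (bx.hlo 2 j s) (bx.hhi 2 j s) y₀ := by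
    intro s hs ζ' y₀ y hN
    obtain ⟨-, -, -, hhinge⟩ := hRn s hs
    obtain ⟨-, -, -, -, -, -, -, -, -, -, -, -, hhull, hnest⟩ := hA s hs
    exact ⟨inBox_hull2_of_hull1 hC hj hs (hhinge _ _ _ hN), inBox_mono (hnest 0) (hhull 0 _ hN.1)⟩
  -- the base point is the node-0 state of its own trajectory, and a `NodeStart 0`
  obtain ⟨hwsx, -, hlinCm, -, -, -, -, -, -, -, hrP0, -, hhull0, hnest0⟩ := hA 0 (Nat.zero_le _)
  have hx0 : NodeStart cd bx j 0 0 (cd.x j 0) :=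
    ⟨0, fun i k _ _ => by simpa using hrP0 0 i k, by rw [hlinCm.map_zero, add_zero]⟩
  have he0 : ∀ i k, 0 ≤ rd.e j 0 i k := (hRn 0 (Nat.zero_le _)).2.2.1
  have hN0 : NodePair cd bx rd j 0 ζ (cd.x j 0) q := by
    refine ⟨hx0, hζ, fun i k hk1 hk2 => ?_⟩
    have e : (q - cd.x j 0 - rd.Vc j 0 ζ) i k = 0 := by
      rw [hVc0]; simp only [Pi.sub_apply, Pi.add_apply, hqζ i k hk1 hk2]; ring
    rw [e, abs_zero]; exact he0 i k
  intro s
  induction s with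
  | zero =>
    intro _
    rw [hT0]
    have hS : 0 < cd.S j := (hC j hj).1
    obtain ⟨hq2, hx2⟩ := hH2y 0 (Nat.zero_le _) hN0
    obtain ⟨hsolq, -⟩ := ((hF.2 j hj).2.2 0 hS).1 _ hq2
    obtain ⟨hsolx, -⟩ := ((hF.2 j hj).2.2 0 hS).1 _ hx2
    have hh0 := ((gridV hC hj).2.1 0 hS).1
    refine ⟨solvesOn_of_le hsolq hh0.le, solvesOn_of_le hsolx hh0.le, ?_⟩
    -- the node-0 states: `stAt (x j 0) 0 = x j 0`, `stAt q 0 = q` on the window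
    have ex : stAt φ j (cd.x j 0) 0 = cd.x j 0 :=
      eq_of_wsupp_of_window (wsupp_stAtU hU hj _ _) hwsx fun i k hk1 hk2 => (hsolx i k hk1 hk2).1
    rw [ex]
    refine ⟨hx0, hζ, fun i k hk1 hk2 => ?_⟩
    have e1 : stAt φ j q 0 i k = q i k := (hsolq i k hk1 hk2).1
    have e : (stAt φ j q 0 - cd.x j 0 - rd.Vc j 0 ζ) i k = 0 := by
      rw [hVc0]; simp only [Pi.sub_apply, Pi.add_apply, e1, hqζ i k hk1 hk2]; ring
    rw [e, abs_zero]; exact he0 i k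
  | succ s IH =>
    intro hs1
    have hs : s < cd.S j := Nat.lt_of_succ_le hs1
    obtain ⟨hsolq, hsolx, hN⟩ := IH hs.le
    obtain ⟨hq2, hx2⟩ := hH2y s hs.le hN
    -- one sub-step from the node states
    obtain ⟨hsolq', -⟩ := ((hF.2 j hj).2.2 s hs).1 _ hq2
    obtain ⟨hsolx', -⟩ := ((hF.2 j hj).2.2 s hs).1 _ hx2
    have hTs := ((gridV hC hj).2.1 s hs).2
    have hh := ((gridV hC hj).2.1 s hs).1
    have hT0' : 0 ≤ cd.Tn j s := (gridV hC hj).2.2.2 s hs.le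
    obtain ⟨hq1, hqe⟩ := solvesOn_appendU hU hj hT0' hh.le hsolq hsolq'
    obtain ⟨hx1, hxe⟩ := solvesOn_appendU hU hj hT0' hh.le hsolx hsolx'
    rw [← hTs] at hq1 hx1 hqe hxe
    have eq1 : stAt φ j q (cd.Tn j (s + 1)) = stAt φ j (stAt φ j q (cd.Tn j s)) (cd.h j s) := by
      rw [hqe _ ⟨by rw [hTs]; linarith, le_rfl⟩, hTs, add_sub_cancel_left]
    have ex1 : stAt φ j (cd.x j 0) (cd.Tn j (s + 1)) = stAt φ j (stAt φ j (cd.x j 0) (cd.Tn j s)) (cd.h j s) := by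
      rw [hxe _ ⟨by rw [hTs]; linarith, le_rfl⟩, hTs, add_sub_cancel_left]
    refine ⟨hq1, hx1, ?_⟩
    rw [eq1, ex1]
    exact nodePair_step hC hR hF hj hs hN

/-- **The node invariant, packaged** (levels 1 and 0, all stages): every polytope trajectory solves on
`[0, Tn S]` with its nodes in the level-1 hulls, and the base trajectory's nodes are `NodeStart 0` states (in the
level-0 hulls). [folklore] -/
theorem polyInvariantV (hC : ChainVCore cd bx) (hR : ChainVRadii cd bx rd) (hF : IsFlowPackageV cd bx φ) :
    (∀ j, j ≤ cd.N₀ → ∀ q, InPoly cd j q →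
      SolvesOn cd φ j q (cd.Tn j (cd.S j)) ∧
        ∀ s, s ≤ cd.S j → InBox cd (bx.hlo 1 j s) (bx.hhi 1 j s) (stAt φ j q (cd.Tn j s))) ∧
    (∀ j, j ≤ cd.N₀ → InPoly cd j (cd.x j 0) → ∀ s, s ≤ cd.S j →
      NodeStart cd bx j s 0 (stAt φ j (cd.x j 0) (cd.Tn j s)) ∧
        InBox cd (bx.hlo 0 j s) (bx.hhi 0 j s) (stAt φ j (cd.x j 0) (cd.Tn j s))) := by
  constructor
  · intro j hj q hq
    obtain ⟨ζ, -, -, hN⟩ := polyNodesV hC hR hF hj hq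
    obtain ⟨-, -, -, -, -, -, hRn, -⟩ := hR j hj
    refine ⟨(hN _ le_rfl).1, fun s hs => ?_⟩
    obtain ⟨-, -, -, hhinge⟩ := hRn s hs
    exact hhinge _ _ _ (hN s hs).2.2
  · intro j hj hx s hs
    obtain ⟨ζ, -, -, hN⟩ := polyNodesV hC hR hF hj hx
    have h1 := (hN s hs).2.2.1
    obtain ⟨-, -, -, -, -, -, -, -, -, -, -, -, hhull, -⟩ := (hC j hj).2.2.1 s hs
    exact ⟨h1, hhull 0 _ h1⟩

end Summit.NavierStokesRegularity.NavierStokesRegularity.Theorems.TaylorModelV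

end
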